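import Literature.Analysis.Convexity.CanonicalComplex
import Literature.ModelTheory.ExponentialFields.SemialgebraicTriangulationTheorem
import HarnessLib

/-!
# Standardizing a finite simplicial complex: the coordinate realisation as a semialgebraic
# homeomorphism

Topic `Literature/ModelTheory/ExponentialFields` — a small bridge used by the `C¹` layer of the
`C¹`-triangulation theorem [OhmotoShiota2017]: a finite simplicial complex `K` in `ℝᵈ` is replaced
by its canonical coordinate realisation `Kc` in `ℝᴺ` (all vertices coordinate vectors `e i`,
`Literature.Analysis.Convexity.canonical`), the realisation map `π x = Σ xᵢ vᵢ` being a
**semialgebraic homeomorphism** `|Kc| → |K|` carrying open simplices onto open simplices.  After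
this change of the triangulating complex all vertices are affinely independent at once, which is
the setting in which the panel-beating squeezes of [CzaplaPawlucki2018, §2 Part II] are performed
(`SemialgebraicPanelBeating.lean`).

* `image_real_openSimplex` — `π` maps the open coordinate simplex of a face onto the open simplex;
* `exists_coordinate_realisation` — the packaged statement: `Kc` finite and coordinate
  (`IsCoordinate`), `IsSemialgHomeomorphOn ℝ Kc.space K.space π π⁻¹`, faces and open simplices
  correspond.

No named facts are introduced.

## References

* [CzaplaPawlucki2018] M. Czapla, W. Pawłucki, *Strict `C¹`-triangulations in o-minimal
  structures*, TMNA 52 (2018), §2.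
* [OhmotoShiota2017] T. Ohmoto, M. Shiota, *`C¹`-triangulations of semialgebraic sets*,
  J. Topology 10 (2017), §3.
-/

open Set Filter Function
open _root_.Topology

namespace Literature.ModelTheory.ExponentialFields

open Literature.NumberTheory.Transcendental (IsSemialgebraicFunOn IsSemialgebraicMapOn)
open Literature.Analysis.Convexity

section Standard

variable {d N : ℕ}

/-- **The realisation carries open coordinate simplices onto open simplices**: for a vertex set
`s` covered injectively by the enumeration, `π (Int (coordSimplex (idx s))) = Int s`.
[cite: Dries1998, Ch. 8 (1.4)] -/
theorem image_real_openSimplex {vtx : Fin N → (Fin d → ℝ)} (hinj : Injective vtx)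
    {s : Finset (Fin d → ℝ)} (hs : ∀ v ∈ s, ∃ i, vtx i = v) :
    real vtx '' openSimplex ℝ (coordSimplex (idx vtx s)) = openSimplex ℝ s := by
  classical
  set I : Finset (Fin N) := idx vtx s with hI
  have hsI : s = I.image vtx := (image_vtx_idx hs).symm
  have hinjI : Set.InjOn vtx (I : Set (Fin N)) := hinj.injOn
  have hinjE : Set.InjOn (fun i : Fin N => (Pi.single i 1 : Fin N → ℝ)) (I : Set (Fin N)) :=
    single_one_injective.injOn
  -- the index of a vertex (by choice; `vtx` is injective)
  let u' : ((Fin N → ℝ) → ℝ) → (Fin d → ℝ) → ℝ := fun w v =>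
    if h : ∃ i, vtx i = v then w (Pi.single h.choose 1) else 0
  have hu' : ∀ (w : (Fin N → ℝ) → ℝ) (i : Fin N), u' w (vtx i) = w (Pi.single i 1) := by
    intro w i
    have h : ∃ j, vtx j = vtx i := ⟨i, rfl⟩
    simp only [u', dif_pos h]
    rw [hinj h.choose_spec]
  apply Subset.antisymm
  · rintro _ ⟨x, ⟨w, hw0, hw1, hwx⟩, rfl⟩
    -- weights on `s`: `u (vtx i) = w (e i)`
    refine ⟨u' w, fun v hv => ?_, ?_, ?_⟩
    · obtain ⟨i, rfl⟩ := hs v hv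
      rw [hu']
      exact hw0 _ (single_mem_coordSimplex_iff.2 (mem_idx_iff.2 hv))
    · rw [hsI, Finset.sum_image hinjI]
      rw [coordSimplex, Finset.sum_image hinjE] at hw1
      rw [← hw1]
      exact Finset.sum_congr rfl fun i _ => by rw [hu']
    · rw [hsI, Finset.sum_image hinjI, ← hwx, coordSimplex, Finset.sum_image hinjE, map_sum]
      refine Finset.sum_congr rfl fun i _ => ?_
      rw [hu', map_smul, real_single]
  · rintro y ⟨u, hu0, hu1, huy⟩
    refine ⟨∑ i ∈ I, u (vtx i) • (Pi.single i 1 : Fin N → ℝ), ⟨fun e => u (real vtx e), ?_, ?_, ?_⟩, ?_⟩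
    · intro e he
      obtain ⟨i, hi, rfl⟩ := mem_coordSimplex_iff.1 he
      show 0 < u (real vtx (Pi.single i 1))
      rw [real_single]
      exact hu0 _ (mem_idx_iff.1 hi)
    · rw [coordSimplex, Finset.sum_image hinjE]
      simp only [real_single]
      rw [← hu1, hsI, Finset.sum_image hinjI]
    · rw [coordSimplex, Finset.sum_image hinjE]
      simp only [real_single]
    · rw [map_sum]
      simp only [map_smul, real_single]
      rw [← huy, hsI, Finset.sum_image hinjI]

/-- The underlying space of a coordinate complex is semialgebraic (a finite union of simplices).
[cite: BochnakCosteRoy1998, §2.1] -/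
theorem isSemialgebraic_space_of_finite {M : ℕ} (K : Geometry.SimplicialComplex ℝ (Fin M → ℝ))
    (hK : K.faces.Finite) : IsSemialgebraic ℝ K.space := by
  have h : K.space = ⋃ s ∈ hK.toFinset, convexHull ℝ (s : Set (Fin M → ℝ)) := by
    ext x
    simp [Geometry.SimplicialComplex.mem_space_iff]
  rw [h]
  exact IsSemialgebraic.biUnion _ _ fun s hs =>
    isSemialgebraic_convexHull_of_affineIndependent' (K.indep (hK.mem_toFinset.mp hs))

/-- **Standardization of a finite simplicial complex** (the canonical coordinate realisation of
`Literature.Analysis.Convexity.CanonicalComplex`, packaged as a semialgebraic homeomorphism):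
a finite complex `K` in `ℝᵈ` is the image of a finite *coordinate* complex `Kc` in some `ℝᴺ`
(all vertices coordinate vectors, hence affinely independent all at once) under a linear map `π`
which is a semialgebraic homeomorphism `|Kc| → |K|` carrying faces to faces and open simplices
onto open simplices. [cite: CzaplaPawlucki2018, §2 Part II] -/
theorem exists_coordinate_realisation (K : Geometry.SimplicialComplex ℝ (Fin d → ℝ))
    (hK : K.faces.Finite) :
    ∃ (N : ℕ) (Kc : Geometry.SimplicialComplex ℝ (Fin N → ℝ)) (π : (Fin N → ℝ) →ₗ[ℝ] (Fin d → ℝ))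
      (πinv : (Fin d → ℝ) → (Fin N → ℝ)),
      Kc.faces.Finite ∧ IsCoordinate Kc ∧
      IsSemialgHomeomorphOn ℝ Kc.space K.space π πinv ∧
      (∀ t ∈ Kc.faces, t.image π ∈ K.faces ∧ π '' openSimplex ℝ t = openSimplex ℝ (t.image π) ∧
        π '' convexHull ℝ (t : Set (Fin N → ℝ)) = convexHull ℝ ((t.image π : Finset _) : Set (Fin d → ℝ))) ∧
      (∀ s ∈ K.faces, ∃ t ∈ Kc.faces, t.image π = s) := by
  classical
  obtain ⟨N, vtx, hinj, hrange, -⟩ := exists_vertex_enumeration hK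
  let Kc := canonical K vtx hinj hrange
  have hKc : Kc.faces.Finite := canonical_faces_finite hK
  have hcoord : IsCoordinate Kc := isCoordinate_canonical
  have hinjOn : InjOn (real vtx) Kc.space := injOn_real_canonical_space
  have himg : real vtx '' Kc.space = K.space := image_real_canonical_space
  have hcompact : IsCompact Kc.space := hcoord.isCompact_space
  -- the inverse
  let πinv : (Fin d → ℝ) → (Fin N → ℝ) := Function.invFunOn (real vtx) Kc.space
  have hleft : ∀ x ∈ Kc.space, πinv (real vtx x) = x := fun x hx =>
    hinjOn.leftInvOn_invFunOn hx
  have hright : ∀ y ∈ K.space, real vtx (πinv y) = y := fun y hy => by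
    rw [← himg] at hy
    exact Function.invFunOn_eq hy
  have hmaps : MapsTo πinv K.space Kc.space := fun y hy => by
    rw [← himg] at hy
    exact Function.invFunOn_mem hy
  have hcont : Continuous (real vtx) := (real vtx).continuous_of_finiteDimensional
  -- continuity of the inverse, from compactness
  have hcont_inv : ContinuousOn πinv K.space := by
    rw [continuousOn_iff_isClosed]
    intro C hC
    refine ⟨real vtx '' (C ∩ Kc.space), ((hcompact.inter_left hC).image hcont).isClosed, ?_⟩
    ext y
    constructor
    · rintro ⟨hyC, hyK⟩
      refine ⟨⟨πinv y, ⟨hyC, hmaps hyK⟩, hright y hyK⟩, hyK⟩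
    · rintro ⟨⟨x, ⟨hxC, hxK⟩, rfl⟩, -⟩
      refine ⟨?_, himg ▸ ⟨x, hxK, rfl⟩⟩
      show πinv (real vtx x) ∈ C
      rwa [hleft x hxK]
  have hhomeo : IsSemialgHomeomorphOn ℝ Kc.space K.space (real vtx) πinv :=
    ⟨fun x hx => himg ▸ ⟨x, hx, rfl⟩, hmaps, hleft, hright, hcont.continuousOn, hcont_inv,
      LinearMap.isSemialgebraicMapOn' (real vtx) (isSemialgebraic_space_of_finite Kc hKc)⟩
  refine ⟨N, Kc, real vtx, πinv, hKc, hcoord, hhomeo, fun t ht => ?_, fun s hs => ?_⟩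
  · obtain ⟨s, hs, rfl⟩ := mem_canonical_faces.1 ht
    have h1 : (coordSimplex (idx vtx s)).image (real vtx) = s := image_real_coordSimplex_idx (hrange s hs)
    refine ⟨by rw [h1]; exact hs, ?_, ?_⟩
    · rw [h1]
      exact image_real_openSimplex hinj (hrange s hs)
    · rw [h1]
      exact image_real_convexHull (hrange s hs)
  · exact ⟨_, mem_canonical_faces.2 ⟨s, hs, rfl⟩, image_real_coordSimplex_idx (hrange s hs)⟩

end Standard

end Literature.ModelTheory.ExponentialFields
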